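import Summits.Ventures.PercRepro.ProfilePointedCircuitClassesReplacementThree

/-!
# PercRepro — THE PER-SET INEQUALITY (PS) FOR TWO-POINT SETS (`n = 10`, `ρ = 6`, no coloops)
(p5, gen 46; `proofs/P5-GM1.md` §68)

For a two-point set `C` and a point `e ∉ C` of a coloop-free matroid with `10` points and rank `6`:
`thru_4(C + e) ≤ #{T ∈ BI_5 : C ⊆ T, e ∉ T}` (`thruCount_four_insert_le_of_card_two`).  A double counting of the
relation `X − e ⊆ T` between the demands `X ⊇ C + e` and the units `T ⊇ C` avoiding `e`: every demand has at least
three such units (`three_le_card_filter_replacement`, all of which contain `C ⊆ X − e`), and a unit `T` has at most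
three such demands — `X ↦ X ∖ (C + e)` injects them into the one-point subsets of the three-point set `T ∖ C`.
With the three-point case `thruCount_four_insert_le_of_card_three`, the per-set inequality of §67(g) is now a
theorem for every set `C ∌ e` with `|C| ∈ {2, 3}`; the cases `|C| ≤ 1` (`|C| = 0` is the `n = 10` theorem) need
the charging of §59.
-/

open scoped Matroid

namespace PercRepro.Cogirth

open Finset ThmH Skew Shadow Profile

variable {α : Type} [DecidableEq α] {N : Matroid α} [N.Finite]

section ReplacementPair

/-- **THE PER-SET INEQUALITY FOR A TWO-POINT SET** ((PS) of §67(g), `|C| = 2`): on a coloop-free matroid with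
`#E = 10` and `ρ = 6`, for every two-point set `C` and every `e ∉ C`, the bi-independent `4`-sets through `C + e`
are at most the bi-independent `5`-sets containing `C` and avoiding `e`. -/
theorem thruCount_four_insert_le_of_card_two (hn : (gr N).card = 10) (hR : rk N (gr N) = 6)
    (hcf : ∀ x ∈ gr N, rk N ((gr N).erase x) = 6) {C : Finset α} (hC2 : C.card = 2) {e : α} (heC : e ∉ C) :
    thruCount N 4 (insert e C) ≤ ((biIndepSets N 5).filter (fun T => C ⊆ T ∧ e ∉ T)).card := by
  unfold thruCount
  have key : ((biIndepSets N 4).filter (fun X => insert e C ⊆ X)).card * 3 ≤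
      ((biIndepSets N 5).filter (fun T => C ⊆ T ∧ e ∉ T)).card * 3 := by
    refine card_mul_le_card_mul (fun (X T : Finset α) => X.erase e ⊆ T) ?_ ?_
    · -- every demand has at least three units above it
      intro X hX
      rw [mem_filter] at hX
      have he : e ∈ X := hX.2 (mem_insert_self e C)
      have h3 := three_le_card_filter_replacement hn hR hcf hX.1 he
      refine h3.trans (card_le_card ?_)
      intro T hT
      rw [mem_filter] at hT
      rw [mem_bipartiteAbove, mem_filter]
      refine ⟨⟨hT.1, ?_, hT.2.1⟩, hT.2.2⟩
      intro c hc
      exact hT.2.2 (mem_erase.2 ⟨fun h => heC (h ▸ hc), hX.2 (mem_insert_of_mem hc)⟩)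
    · -- every unit has at most three demands below it
      intro T hT
      rw [mem_filter] at hT
      have hTC : (T \ C).card = 3 := by
        rw [card_sdiff_of_subset hT.2.1, (mem_biIndepSets.1 hT.1).2.1, hC2]
      calc (((biIndepSets N 4).filter (fun X => insert e C ⊆ X)).bipartiteBelow
            (fun (X T : Finset α) => X.erase e ⊆ T) T).card
          ≤ ((T \ C).powersetCard 1).card := ?_
        _ = 3 := by rw [card_powersetCard, hTC, Nat.choose_one_right]
      apply card_le_card_of_injOn (fun X => X \ insert e C)
      · intro X hX
        rw [mem_coe, mem_bipartiteBelow, mem_filter] at hX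
        obtain ⟨⟨hX4, hXC⟩, hXT⟩ := hX
        show X \ insert e C ∈ (T \ C).powersetCard 1
        rw [mem_powersetCard]
        refine ⟨?_, ?_⟩
        · intro x hx
          rw [mem_sdiff, mem_insert, not_or] at hx
          rw [mem_sdiff]
          exact ⟨hXT (mem_erase.2 ⟨hx.2.1, hx.1⟩), hx.2.2⟩
        · rw [card_sdiff_of_subset hXC, (mem_biIndepSets.1 hX4).2.1, card_insert_of_notMem heC, hC2]
      · intro X₁ hX₁ X₂ hX₂ h
        rw [mem_coe, mem_bipartiteBelow, mem_filter] at hX₁ hX₂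
        have h₁ : X₁ \ insert e C ∪ insert e C = X₁ := sdiff_union_of_subset hX₁.1.2
        have h₂ : X₂ \ insert e C ∪ insert e C = X₂ := sdiff_union_of_subset hX₂.1.2
        rw [← h₁, ← h₂]
        exact congrArg (fun S => S ∪ insert e C) h
  omega

end ReplacementPair

end PercRepro.Cogirth
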